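import Literature.MathematicalPhysics.QuantumFieldTheory.Balaban1983to89.B11Eq161HBChain

/-!
# `Balaban1983to89.B11Eq161HBChainLevelRadii` — T. Bałaban, *The variational problem and background fields in renormalization group method for lattice
# gauge theories*, Commun. Math. Phys. **102** (1985) 277–309 [Balaban1985Variational], Sect. F (161)–(164) pp. 303–304: the `H`-kernel chain READ WITH
# LEVEL-DEPENDENT CLASS RADII on the far cells (the currency of NODE 00's one-step fact `HalvingStepTop`), kernel-checked from r08's chain by a rate tilt

statement-level skeleton of published theorems with citation tags; proofs where landed; nothing here is a claim about the Yang–Mills mass gap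

Cell `pub-ymgap`, seat `pub-ymgap-k0-s1-w3` generation 0 (D-0149 width seat 3∕3 on K0⁷ `stmt-QuantumFields-20541`, V18 stub 1 `stub_prop8StepCoP13`; plan g77∕g78
W-SEAT-START-LIST v3∕v4 row k0-s1 sub-target S5 = (160)–(164) «with the collar letter a parameter», plan g78 WORDS-2).  CONSUMED BY NAME, nothing modified:
r08's `B11Eq161HBChain` (`kernelSum`, `line4`, `ineq161`), b2b-pv21's `B11B3` (`sum162`, `ineq161_le_quarter_B3`).  `--kind proof --supports stmt-QuantumFields-20541`.

WHY (the located typing point of dag-n07-e module 30 `Node00/CriticalOnFibreTopHalving`, made quantitative for S5).  Print runs Sect. F with ONE class radius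
`ε₀` and ONE data threshold `ε₁`; the far cells `y₂ ∈ ℭ_k ∖ □_k` of (161) carry the bound (155) `|B| < 18d²L³Mε₀` and are damped by `e^{−½δ₀R₁M₁}` ((144):
`d(y₁,y₂) ≥ R₁M₁`), whence (163) `B₃e^{−½δ₀R₁M₁} ≤ ½` ⇒ (164) `< ¼M_Δ max{B₃ε₁, ½ε₀}`.  At NODE 00's objects the one-step fact is typed with LEVEL-DEPENDENT
radii `ε : ℕ → ℝ`, two-sided 2-comparable (`ε_n ≤ 2ε_{n+1}`, `ε_{n+1} ≤ 2ε_n`): a far cell at level `j₂` carries `|B| < 18d²L³M·ε_{j₂}` with only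
`ε_{j₂} ≤ 2^{k−j₂}·ε_k` available — a factor the damping `e^{−½δ₀R₁M₁}` of ONE gap does not absorb (a cell `k − j₂` levels down sits behind `k − j₂` gaps).
THIS FILE shows that the layer separation already used by (162) ([3] (2.60): `d(y₁,y₂) ≥ G·(k − j₂ − g)`, `G` = the collar gap per level — print's `R₁M₁`,
here a PARAMETER —, `g` = the scale allowance of the observation point) pays it: tilting the rate by `τ = (log 2)∕G` turns the level-dependent far
bound into print's uniform one at `ε₀ := 2^g·ε_k` and rate `δ₀ − τ`, so r08's END-TO-END chain applies VERBATIM, and a (163) strengthened by the factor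
`2^{g}∕θ` — `B₃e^{−½(δ₀−τ)G}·2^g ≤ θ` — lands (164) at `¼M_Δ max{B₃ε₁, θ·ε_k}` in the level-`k` currency (print's shape at `θ = ½`; the S6 assembly's
budget token `LocalLetters165TopStep` of dag-n07-w4 takes the far coefficient as its own letter, so `θ` is DISPLAYED).  The near cells (levels `k−1`, `k`) are
print's: their data thresholds `δ_{k−1} ≤ 2δ_k` enter (160) as `ε₁ := 2δ_k` at the instance (monotonicity, nothing to prove here).  The collar gap `G`,
the geometry (`B6.Geometry`, `ℭ = Cn ∪ Cf`) and the `H`-kernel bound stay PARAMETERS ∕ HYPOTHESES exactly as in r08's file (their instances at NODE 00's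
objects are the S1∕S3∕S4 sub-targets and the collar word LOCATED-S5-1, evidence #20 on the crux item).

CONTENTS.  §1 `kernelSum_tilt` (the rate-tilt identity `e^{−δ₀d} = e^{−(δ₀−τ)d}·e^{−τd}` inside member 1), `tilt_far_le` (`e^{−τd}·2^{k−j₂} ≤ 2^g` from
the layer separation, `τG = log 2`), `absB_tilt_near_le` ∕ `absB_tilt_far_le` (the tilted cell data obey print's (160) ∕ (155) shapes at `ε₀ := 2^g ε_k`);
§2 `line4_le_quarter_of_far` (r08's `line4_le_quarter` with the far smallness as a PARAMETER: `B₃e^{−½δ₀'G}·ε₀ ≤ ½ε′` ⇒ `line4 ≤ ¼M_Δ max{B₃ε₁, ½ε′}`);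
§3 ★★ `ineq164_levelRadii` — (164) IN THE LEVEL-DEPENDENT CURRENCY: `Q ≤ kernelSum` with far data `|B(y₂)| ≤ 18d²L³M·ε(scale y₂)`, `ε(j) ≤ 2^{k−j}ε(k)`,
separation `G(k − scale y₂ − g) ≤ d(y₁,y₂)` on far cells, (162)∕(163′) at the tilted rate with the far coefficient `θ` displayed ⇒ `Q ≤ ¼M_Δ max{B₃ε₁, θ·ε(k)}`
(print: `θ = ½`); `ineq164_levelRadii_of_comparable`
(the comparability `ε n ≤ 2ε(n+1)` form of the hypothesis).

HONEST SCOPE.  Kernel-checked BOOKKEEPING (real exponentials and finite sums) on top of r08's certified chain; NOTHING of [15]'s analysis is asserted: member 1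
(the `H`-kernel bound, [5] Thm 3.12 ∕ (46)), (160), (155), the geometry of ℭ_k and the layer separation ([3] (2.60)) are HYPOTHESES as in `B11Eq161HBChain` ∕
`B11B3`; the strengthened (163′) is DISPLAYED as a hypothesis (a smallness of the collar gap `G`, cf. `B11B3`'s located «½δ₀R₁M₁ > log L»).  Count-neutral;
N07 NOT discharged; K0⁷ ∕ stub 1 NOT closed; one finite T⁴ programme at fixed ε — not continuum ∕ ℝ⁴ ∕ OS ∕ mass gap ∕ Clay.  No `sorry`, no `def`, no `instance`.
-/

namespace Literature.MathematicalPhysics.QuantumFieldTheory.Balaban1983to89.B11Eq161HBChainLevelRadii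

open Literature.MathematicalPhysics.QuantumFieldTheory.Balaban1983to89
open Finset B11B3 B11Eq161HBChain

variable {g : B6.Geometry} {d : ℕ}

/-! ## §1 The rate tilt -/

/-- **The rate-tilt identity inside (161)'s first member**: `e^{−δ₀d} = e^{−(δ₀−τ)d}·e^{−τd}`, so the kernel sum at rate `δ₀` with cell data `|B(c)|` IS
the kernel sum at rate `δ₀ − τ` with the tilted data `e^{−τd(y₁,c₋)}|B(c)|`. [cite: Balaban1985Variational, (161) p.303 (bookkeeping)] -/
theorem kernelSum_tilt (δ₀ τ B₀ : ℝ) (C : Finset g.Site) (absB : g.Site → Fin d → ℝ) (y₁ : g.Site) :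
    kernelSum g d δ₀ B₀ C absB y₁ =
      kernelSum g d (δ₀ - τ) B₀ C (fun y₂ μ => Real.exp (-(τ * g.dist y₁ y₂)) * absB y₂ μ) y₁ := by
  unfold kernelSum
  congr 1
  refine Finset.sum_congr rfl fun y₂ _ => Finset.sum_congr rfl fun μ _ => ?_
  have h : Real.exp (-(δ₀ * g.dist y₁ y₂)) = Real.exp (-((δ₀ - τ) * g.dist y₁ y₂)) * Real.exp (-(τ * g.dist y₁ y₂)) := by
    rw [← Real.exp_add]; congr 1; ring
  rw [h]; ring

/-- **The layer separation pays the level factor**: if `2 ≤ e^{τG}` (`τG ≥ log 2`), `0 ≤ τ`, `0 ≤ d(y₁,y₂)` and the far cell at level `j₂ ≤ k` sits behind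
`k − j₂ − g` gaps (`G·(k − j₂ − g) ≤ d(y₁,y₂)`, [3] (2.60) as used by (162)), then `e^{−τd(y₁,y₂)}·2^{k−j₂} ≤ 2^g`.
[cite: Balaban1984PropagatorsII, (2.60) p.234; Balaban1985Variational, (162) p.303 (bookkeeping)] -/
theorem tilt_far_le {τ G t : ℝ} {k j gap : ℕ} (hτ : 0 ≤ τ) (h2 : 2 ≤ Real.exp (τ * G)) (ht : 0 ≤ t) (hj : j ≤ k)
    (h60 : G * ((k : ℝ) - j - gap) ≤ t) :
    Real.exp (-(τ * t)) * (2 : ℝ) ^ (k - j) ≤ (2 : ℝ) ^ gap := by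
  obtain ⟨m, hm⟩ : ∃ m : ℕ, k = j + m := ⟨k - j, by omega⟩
  have hkj : k - j = m := by omega
  rw [hkj]
  have h1 : Real.exp (-(τ * t)) ≤ 1 := by
    rw [Real.exp_le_one_iff]; nlinarith [mul_nonneg hτ ht]
  by_cases hmg : m ≤ gap
  · calc Real.exp (-(τ * t)) * (2 : ℝ) ^ m ≤ 1 * (2 : ℝ) ^ m := by gcongr
      _ ≤ (2 : ℝ) ^ gap := by rw [one_mul]; exact pow_le_pow_right₀ one_le_two hmg
  · obtain ⟨n, hn⟩ : ∃ n : ℕ, m = gap + n := ⟨m - gap, by omega⟩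
    have h60' : G * (n : ℝ) ≤ t := by
      have hcast : ((k : ℝ) - j - gap) = (n : ℝ) := by rw [hm, hn]; push_cast; ring
      rwa [hcast] at h60
    -- `e^{-τ t} ≤ e^{-τ G n} = (e^{τG})⁻¹ ^ n ≤ (2⁻¹) ^ n`
    have hq : Real.exp (-(τ * t)) ≤ (Real.exp (τ * G))⁻¹ ^ n := by
      rw [← Real.exp_neg, ← Real.exp_nat_mul, Real.exp_le_exp]
      nlinarith [mul_le_mul_of_nonneg_left h60' hτ]
    have hE : 0 < Real.exp (τ * G) := Real.exp_pos _
    have h2n : (Real.exp (τ * G))⁻¹ ^ n ≤ ((2 : ℝ)⁻¹) ^ n :=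
      pow_le_pow_left₀ (inv_nonneg.mpr hE.le) ((inv_le_inv₀ hE two_pos).mpr h2) n
    have h22 : ((2 : ℝ)⁻¹) ^ n * (2 : ℝ) ^ n = 1 := by rw [inv_pow, inv_mul_cancel₀ (pow_ne_zero _ two_ne_zero)]
    rw [hn, pow_add]
    calc Real.exp (-(τ * t)) * ((2 : ℝ) ^ gap * 2 ^ n) ≤ ((2 : ℝ)⁻¹) ^ n * ((2 : ℝ) ^ gap * 2 ^ n) :=
          mul_le_mul_of_nonneg_right (hq.trans h2n) (by positivity)
      _ = (2 : ℝ) ^ gap * (((2 : ℝ)⁻¹) ^ n * 2 ^ n) := by ring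
      _ = (2 : ℝ) ^ gap := by rw [h22, mul_one]

/-- **Two-sided comparability ⇒ the level factor**: `ε_n ≤ 2ε_{n+1}` for `n < k` gives `ε_j ≤ 2^{k−j}·ε_k` for `j ≤ k` (the shape in which NODE 00's one-step
fact `HalvingStepTop` displays its class radii). [cite: Balaban1988Convergent, (2.7)–(2.8) pp.255–256 (bookkeeping)] -/
theorem le_two_pow_mul_of_comparable {ε : ℕ → ℝ} {k : ℕ} (hcomp : ∀ n, n < k → ε n ≤ 2 * ε (n + 1)) {j : ℕ} (hj : j ≤ k) :
    ε j ≤ (2 : ℝ) ^ (k - j) * ε k := by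
  obtain ⟨m, rfl⟩ : ∃ m : ℕ, k = j + m := ⟨k - j, by omega⟩
  rw [Nat.add_sub_cancel_left]
  induction m with
  | zero => simp
  | succ m ih =>
    have h1 : ε j ≤ 2 ^ m * ε (j + m) := ih (fun n hn => hcomp n (by omega)) (by omega)
    have h2 : ε (j + m) ≤ 2 * ε (j + m + 1) := hcomp (j + m) (by omega)
    calc ε j ≤ 2 ^ m * ε (j + m) := h1
      _ ≤ 2 ^ m * (2 * ε (j + m + 1)) := mul_le_mul_of_nonneg_left h2 (by positivity)
      _ = 2 ^ (m + 1) * ε (j + (m + 1)) := by rw [pow_succ]; ring_nf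

/-! ## §2 (162), (163′) ⇒ (164) with the far smallness as a parameter -/

/-- **(162), (163′) ⇒ (164), the far smallness DISPLAYED** — r08's `line4_le_quarter` with its use of (163) isolated: if the inner sum of (162) is `≤ S`,
`B₃ = 72d³L³B₀S`, and the far contribution obeys `B₃e^{−½δ₀G}·ε₀ ≤ ½ε′`, then member 5 of (161) is `≤ ¼M_Δ max{B₃ε₁, ½ε′}`.  (At `ε′ = ε₀` and (163)
`B₃e^{−½δ₀R₁M₁} ≤ ½` this is (164) as printed.) [cite: Balaban1985Variational, (162)–(164) pp.303–304 (bookkeeping)] -/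
theorem line4_le_quarter_of_far {δ₀ B₀ ε₁ ε₀ ε' G MΔ S B₃ : ℝ} {C : Finset g.Site} {y₁ : g.Site}
    (hB₀ : 0 ≤ B₀) (hL : 0 ≤ g.L) (hε₁ : 0 ≤ ε₁) (hMΔ : 0 ≤ MΔ)
    (hS : sum162 g δ₀ C y₁ ≤ S) (hB₃ : B₃ = 72 * (d : ℝ) ^ 3 * g.L ^ 3 * B₀ * S)
    (hfar : B₃ * Real.exp (-(δ₀ / 2 * G)) * ε₀ ≤ ε' / 2) :
    line4 g d δ₀ B₀ ε₁ ε₀ G MΔ C y₁ ≤ 1 / 4 * MΔ * max (B₃ * ε₁) (ε' / 2) := by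
  unfold line4
  set X : ℝ := max ε₁ (Real.exp (-(δ₀ / 2 * G)) * ε₀) with hX
  have hX0 : 0 ≤ X := le_trans hε₁ (le_max_left _ _)
  have hP : 0 ≤ (d : ℝ) ^ 3 * g.L ^ 3 * B₀ := by positivity
  have h1 : 18 * ((d : ℝ) ^ 3 * g.L ^ 3 * B₀) * sum162 g δ₀ C y₁ * (MΔ * X) ≤
      1 / 4 * (72 * ((d : ℝ) ^ 3 * g.L ^ 3 * B₀) * S) * (MΔ * X) :=
    ineq161_le_quarter_B3 _ _ _ _ hP (mul_nonneg hMΔ hX0) hS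
  have h2 : B₃ * X ≤ max (B₃ * ε₁) (ε' / 2) := by
    rcases le_total ε₁ (Real.exp (-(δ₀ / 2 * G)) * ε₀) with h | h
    · rw [hX, max_eq_right h]
      calc B₃ * (Real.exp (-(δ₀ / 2 * G)) * ε₀) = B₃ * Real.exp (-(δ₀ / 2 * G)) * ε₀ := by ring
        _ ≤ ε' / 2 := hfar
        _ ≤ max (B₃ * ε₁) (ε' / 2) := le_max_right _ _
    · rw [hX, max_eq_left h]
      exact le_max_left _ _
  calc 18 * (d : ℝ) ^ 3 * g.L ^ 3 * B₀ * sum162 g δ₀ C y₁ * (MΔ * X)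
      = 18 * ((d : ℝ) ^ 3 * g.L ^ 3 * B₀) * sum162 g δ₀ C y₁ * (MΔ * X) := by ring
    _ ≤ 1 / 4 * (72 * ((d : ℝ) ^ 3 * g.L ^ 3 * B₀) * S) * (MΔ * X) := h1
    _ = 1 / 4 * MΔ * (B₃ * X) := by rw [hB₃]; ring
    _ ≤ 1 / 4 * MΔ * max (B₃ * ε₁) (ε' / 2) := mul_le_mul_of_nonneg_left h2 (by positivity)

/-! ## §3 ★★ (164) in the level-dependent currency -/

/-- ★★ **(161)–(164) WITH LEVEL-DEPENDENT CLASS RADII ON THE FAR CELLS** ([15] p. 303–304 read in NODE 00's one-step currency).  r08's binder block of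
`ineq164` (member 1 `Q ≤ kernelSum` = the `H`-kernel bound at background 1; near∕far split `ℭ = Cn ∪ Cf`; (160) on the near cells at the data threshold `ε₁`;
the triangle inequalities `hρ`∕`hρ₁`; the two printed cases `(M = G ∧ M_Δ = 1) ∨ M_Δ = M`) with THREE changes: (i) the far cells carry (155) at the CLASS RADIUS OF
THEIR OWN LEVEL, `|B(c)| ≤ 18d²L³M·ε(j(c))`, with `ε(j) ≤ 2^{k−j}·ε(k)` (two-sided comparability); (ii) besides (144) `G ≤ d(y₁,y₂)` the far cells obey the layer
separation `G·(k − j(c) − g) ≤ d(y₁,y₂)` ([3] (2.60), the hypothesis `h60` of `B11B3.sum162_le`); (iii) (162) is taken at the TILTED rate `δ₀ − τ` with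
`2 ≤ e^{τG}`, and (163) reads `B₃e^{−½(δ₀−τ)G}·2^g ≤ θ` with the far coefficient `θ` DISPLAYED (print: `θ = ½`; an assembler budgeting the far term
separately takes `θ` smaller).  CONCLUSION: `Q ≤ ¼M_Δ max{B₃ε₁, θ·ε(k)}` — (164) at the level-`k` radius (print's shape at `θ = ½`).  Proof: tilt
member 1 (`kernelSum_tilt`), bound the tilted far data by print's (155) shape at `ε₀ := 2^g ε(k)` (`tilt_far_le`), run r08's `ineq161` VERBATIM, close with
`line4_le_quarter_of_far`. [cite: Balaban1985Variational, (155) p.302, (160)–(164) pp.303–304, (144) p.300; Balaban1984PropagatorsII, (2.60) p.234] -/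
theorem ineq164_levelRadii [DecidableEq g.Site] {δ₀ τ B₀ ε₁ M G MΔ ρ₁ S B₃ θ Q : ℝ} {C Cn Cf : Finset g.Site}
    {absB : g.Site → Fin d → ℝ} {ρ : g.Site → ℝ} {y₁ : g.Site} {ε : ℕ → ℝ} {gap : ℕ}
    (hQ : Q ≤ kernelSum g d δ₀ B₀ C absB y₁)
    (hB₀ : 0 ≤ B₀) (hτ : 0 ≤ τ) (hδτ : τ ≤ δ₀) (h2 : 2 ≤ Real.exp (τ * G)) (hd : 1 ≤ d) (hL : 1 ≤ g.L) (heta : 0 < g.eta)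
    (hε₁ : 0 ≤ ε₁) (hεk : 0 ≤ ε g.k) (hM : 0 ≤ M) (hMΔ : 1 ≤ MΔ) (hC : Cn ∪ Cf = C) (hdisj : Disjoint Cn Cf)
    (hdist : ∀ y₂ ∈ C, 0 ≤ g.dist y₁ y₂) (habsB : ∀ y₂ μ, 0 ≤ absB y₂ μ)
    (h160 : ∀ y₂ ∈ Cn, ∀ μ, absB y₂ μ ≤ (8 * (d : ℝ) ^ 2 * g.L ^ 2 + 4 * g.L ^ 2 * ρ y₂) * ε₁)
    (h155 : ∀ y₂ ∈ Cf, ∀ μ, absB y₂ μ ≤ 18 * (d : ℝ) ^ 2 * g.L ^ 3 * M * ε (g.scale y₂))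
    (hscale : ∀ y₂ ∈ Cf, g.scale y₂ ≤ g.k) (hεcomp : ∀ j, j ≤ g.k → ε j ≤ (2 : ℝ) ^ (g.k - j) * ε g.k)
    (h144 : ∀ y₂ ∈ Cf, G ≤ g.dist y₁ y₂) (h60 : ∀ y₂ ∈ Cf, G * ((g.k : ℝ) - g.scale y₂ - gap) ≤ g.dist y₁ y₂)
    (hρ0 : ∀ y₂ ∈ Cn, 0 ≤ ρ y₂) (hρ : ∀ y₂ ∈ Cn, ρ y₂ ≤ g.dist y₁ y₂ + ρ₁) (hρ₁ : ρ₁ ≤ (d : ℝ) ^ 2 * MΔ)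
    (hcase : (M = G ∧ MΔ = 1) ∨ MΔ = M)
    (hS : sum162 g (δ₀ - τ) C y₁ ≤ S) (hB₃ : B₃ = 72 * (d : ℝ) ^ 3 * g.L ^ 3 * B₀ * S)
    (h163 : B₃ * Real.exp (-((δ₀ - τ) / 2 * G)) * (2 : ℝ) ^ gap ≤ θ) :
    Q ≤ 1 / 4 * MΔ * max (B₃ * ε₁) (θ * ε g.k) := by
  have hn : Cn ⊆ C := hC ▸ Finset.subset_union_left
  have hf : Cf ⊆ C := hC ▸ Finset.subset_union_right
  -- member 1 at the tilted rate with the tilted data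
  set absB' : g.Site → Fin d → ℝ := fun y₂ μ => Real.exp (-(τ * g.dist y₁ y₂)) * absB y₂ μ with habsB'
  have hQ' : Q ≤ kernelSum g d (δ₀ - τ) B₀ C absB' y₁ := by rwa [kernelSum_tilt δ₀ τ] at hQ
  have habsB'0 : ∀ y₂ μ, 0 ≤ absB' y₂ μ := fun y₂ μ => mul_nonneg (Real.exp_pos _).le (habsB y₂ μ)
  have hexp1 : ∀ y₂ ∈ C, Real.exp (-(τ * g.dist y₁ y₂)) ≤ 1 := fun y₂ hy₂ => by
    rw [Real.exp_le_one_iff]; nlinarith [mul_nonneg hτ (hdist y₂ hy₂)]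
  -- (160) survives the tilt (the factor is ≤ 1)
  have h160' : ∀ y₂ ∈ Cn, ∀ μ, absB' y₂ μ ≤ (8 * (d : ℝ) ^ 2 * g.L ^ 2 + 4 * g.L ^ 2 * ρ y₂) * ε₁ := fun y₂ hy₂ μ =>
    calc absB' y₂ μ ≤ 1 * absB y₂ μ := mul_le_mul_of_nonneg_right (hexp1 y₂ (hn hy₂)) (habsB y₂ μ)
      _ ≤ (8 * (d : ℝ) ^ 2 * g.L ^ 2 + 4 * g.L ^ 2 * ρ y₂) * ε₁ := by rw [one_mul]; exact h160 y₂ hy₂ μ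
  -- (155) at the level-dependent radius becomes print's (155) at `ε₀ := 2^g·ε(k)` after the tilt
  have h155' : ∀ y₂ ∈ Cf, ∀ μ, absB' y₂ μ ≤ 18 * (d : ℝ) ^ 2 * g.L ^ 3 * M * ((2 : ℝ) ^ gap * ε g.k) := by
    intro y₂ hy₂ μ
    have hK : 0 ≤ 18 * (d : ℝ) ^ 2 * g.L ^ 3 * M := by
      have : (0 : ℝ) ≤ g.L := by linarith
      positivity
    have ht := tilt_far_le hτ h2 (hdist y₂ (hf hy₂)) (hscale y₂ hy₂) (h60 y₂ hy₂)
    calc absB' y₂ μ = Real.exp (-(τ * g.dist y₁ y₂)) * absB y₂ μ := rfl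
      _ ≤ Real.exp (-(τ * g.dist y₁ y₂)) * (18 * (d : ℝ) ^ 2 * g.L ^ 3 * M * ε (g.scale y₂)) :=
          mul_le_mul_of_nonneg_left (h155 y₂ hy₂ μ) (Real.exp_pos _).le
      _ ≤ Real.exp (-(τ * g.dist y₁ y₂)) * (18 * (d : ℝ) ^ 2 * g.L ^ 3 * M * ((2 : ℝ) ^ (g.k - g.scale y₂) * ε g.k)) :=
          mul_le_mul_of_nonneg_left (mul_le_mul_of_nonneg_left (hεcomp _ (hscale y₂ hy₂)) hK) (Real.exp_pos _).le
      _ = 18 * (d : ℝ) ^ 2 * g.L ^ 3 * M * ((Real.exp (-(τ * g.dist y₁ y₂)) * (2 : ℝ) ^ (g.k - g.scale y₂)) * ε g.k) := by ring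
      _ ≤ 18 * (d : ℝ) ^ 2 * g.L ^ 3 * M * ((2 : ℝ) ^ gap * ε g.k) :=
          mul_le_mul_of_nonneg_left (mul_le_mul_of_nonneg_right ht hεk) hK
  -- r08's chain VERBATIM at the tilted rate
  have hδ' : 0 ≤ δ₀ - τ := by linarith
  have hε₀' : 0 ≤ (2 : ℝ) ^ gap * ε g.k := by positivity
  have h161 := ineq161 (g := g) (d := d) hB₀ hδ' hd hL heta hε₁ hε₀' hMΔ hC hdisj hdist habsB'0 h160' h155' h144 hρ0 hρ hρ₁ hcase
  -- (162), (163′) at the tilted rate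
  have hfar : B₃ * Real.exp (-((δ₀ - τ) / 2 * G)) * ((2 : ℝ) ^ gap * ε g.k) ≤ (2 * θ * ε g.k) / 2 := by
    calc B₃ * Real.exp (-((δ₀ - τ) / 2 * G)) * ((2 : ℝ) ^ gap * ε g.k)
        = (B₃ * Real.exp (-((δ₀ - τ) / 2 * G)) * (2 : ℝ) ^ gap) * ε g.k := by ring
      _ ≤ θ * ε g.k := mul_le_mul_of_nonneg_right h163 hεk
      _ = (2 * θ * ε g.k) / 2 := by ring
  have h := hQ'.trans (h161.trans (line4_le_quarter_of_far hB₀ (by linarith) hε₁ (by linarith) hS hB₃ hfar))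
  have he : (2 * θ * ε g.k) / 2 = θ * ε g.k := by ring
  rwa [he] at h

/-- **(164) in the level-dependent currency, comparability form**: the same with the far-cell radii controlled by NODE 00's two-sided comparability
binder `ε n ≤ 2ε(n+1)` (`n < k`) instead of the closed form `ε j ≤ 2^{k−j}ε k`; far coefficient `θ` displayed. [cite: Balaban1985Variational, (164) p.304; Balaban1988Convergent, (2.7)–(2.8) pp.255–256] -/
theorem ineq164_levelRadii_of_comparable [DecidableEq g.Site] {δ₀ τ B₀ ε₁ M G MΔ ρ₁ S B₃ θ Q : ℝ} {C Cn Cf : Finset g.Site}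
    {absB : g.Site → Fin d → ℝ} {ρ : g.Site → ℝ} {y₁ : g.Site} {ε : ℕ → ℝ} {gap : ℕ}
    (hQ : Q ≤ kernelSum g d δ₀ B₀ C absB y₁)
    (hB₀ : 0 ≤ B₀) (hτ : 0 ≤ τ) (hδτ : τ ≤ δ₀) (h2 : 2 ≤ Real.exp (τ * G)) (hd : 1 ≤ d) (hL : 1 ≤ g.L) (heta : 0 < g.eta)
    (hε₁ : 0 ≤ ε₁) (hεk : 0 ≤ ε g.k) (hM : 0 ≤ M) (hMΔ : 1 ≤ MΔ) (hC : Cn ∪ Cf = C) (hdisj : Disjoint Cn Cf)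
    (hdist : ∀ y₂ ∈ C, 0 ≤ g.dist y₁ y₂) (habsB : ∀ y₂ μ, 0 ≤ absB y₂ μ)
    (h160 : ∀ y₂ ∈ Cn, ∀ μ, absB y₂ μ ≤ (8 * (d : ℝ) ^ 2 * g.L ^ 2 + 4 * g.L ^ 2 * ρ y₂) * ε₁)
    (h155 : ∀ y₂ ∈ Cf, ∀ μ, absB y₂ μ ≤ 18 * (d : ℝ) ^ 2 * g.L ^ 3 * M * ε (g.scale y₂))
    (hscale : ∀ y₂ ∈ Cf, g.scale y₂ ≤ g.k) (hcomp : ∀ n, n < g.k → ε n ≤ 2 * ε (n + 1))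
    (h144 : ∀ y₂ ∈ Cf, G ≤ g.dist y₁ y₂) (h60 : ∀ y₂ ∈ Cf, G * ((g.k : ℝ) - g.scale y₂ - gap) ≤ g.dist y₁ y₂)
    (hρ0 : ∀ y₂ ∈ Cn, 0 ≤ ρ y₂) (hρ : ∀ y₂ ∈ Cn, ρ y₂ ≤ g.dist y₁ y₂ + ρ₁) (hρ₁ : ρ₁ ≤ (d : ℝ) ^ 2 * MΔ)
    (hcase : (M = G ∧ MΔ = 1) ∨ MΔ = M)
    (hS : sum162 g (δ₀ - τ) C y₁ ≤ S) (hB₃ : B₃ = 72 * (d : ℝ) ^ 3 * g.L ^ 3 * B₀ * S)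
    (h163 : B₃ * Real.exp (-((δ₀ - τ) / 2 * G)) * (2 : ℝ) ^ gap ≤ θ) :
    Q ≤ 1 / 4 * MΔ * max (B₃ * ε₁) (θ * ε g.k) :=
  ineq164_levelRadii hQ hB₀ hτ hδτ h2 hd hL heta hε₁ hεk hM hMΔ hC hdisj hdist habsB h160 h155 hscale
    (fun _ hj => le_two_pow_mul_of_comparable hcomp hj) h144 h60 hρ0 hρ hρ₁ hcase hS hB₃ h163

end Literature.MathematicalPhysics.QuantumFieldTheory.Balaban1983to89.B11Eq161HBChainLevelRadii
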